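import Mathlib
import Literature.Analysis.TotalPositivity.MultiplyPositiveProofs
import Literature.Barriers.QuantumFields.WilsonDeterminantSign
import Literature.MathematicalPhysics.QuantumFieldTheory.QCDHeavyQuarkPropagator

/-!
# Cauchy–Binet spectral expansion of the Gram minors of the open core of crux stmt-QuantumFields-9151
(`PauliWegnerSea.PhaseQuenchedFlavourDecay`, line `crossing-split-integrability`, lead c4)

The one open stub of the line, `stub_gramMomentsCore`, asks for phase-quenched `q`-th moments of the
principal `r × r` minors `det((G Gᴴ)[I,I])` of the inverse fermion Gram matrix, `G = (diracMatrix U mq)⁻¹`.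
This file records the exact spectral structure of those minors.

* `det_mul_eq_sum_injective` — Cauchy–Binet over INJECTIVE selections (no order on the index type):
  `det (A B) = (k!)⁻¹ Σ_{p injective} det A[·,p] · det B[p,·]`.
* `det_submatrix_mul_diagonal_mul_star` — principal minors of `U · diag d · Uᴴ`:
  `det((U diag d Uᴴ)[I,I]) = (r!)⁻¹ Σ_{T injective} det U[I,T] · (∏_{b} d (T b)) · conj det U[I,T]`.
* `inv_mul_inv_conjTranspose_eq_spectral` — for Hermitian invertible `A`: `A⁻¹ A⁻ᴴ = Ψ diag(λ⁻²) Ψᴴ`.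
* `det_gram_submatrix_eq_sum` — hence `det((A⁻¹A⁻ᴴ)[I,I]) = (r!)⁻¹ Σ_T ‖det Ψ[I,T]‖² ∏_{b} λ_{T b}⁻²`, and
  `sum_norm_sq_det_submatrix_eq_factorial` — `Σ_T ‖det Ψ[I,T]‖² = r!` for injective `I` (unitary `Ψ`): the Gram
  minor is the MEAN of `∏_{t ∈ T} λ_t⁻²` under the projection determinantal point process of the local `r`-frame
  `Ψ[I,·]` (an `r`-level eigenfunction-weighted inverse spectral moment: for `r ≥ 2` locality sits in the weights).
* `gram_submatrix_rpow_le_sum` — Jensen (`q ≥ 1`): `det((A⁻¹A⁻ᴴ)[I,I])^q ≤ (r!)⁻¹ Σ_T ‖det Ψ[I,T]‖² ∏ |λ_{T b}|^{-2q}`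
  (for `q < 1` use subadditivity of `x ↦ x^q` instead; the weights then lose their normalisation).
* The Wilson–Dirac instance (`stub_gramSpectralExpansion`, registered additive stub of the crux): the same-flavour
  Gram block of `(diracMatrix U mq)⁻¹` at rows `(f, I ·)` is dominated by (and, off the null set where some flavour
  determinant vanishes, equal to) the spectral sum for `H_f = Γ₅ D_W(U, m_f)`.
-/

noncomputable section
namespace Summit.QuantumFields.QCD.Cruxes.PhaseQuenchedFlavourDecay.CrossingSplitIntegrability

open scoped BigOperators ComplexConjugate
open MeasureTheory Filter Matrix Finset
open Literature.MathematicalPhysics.QuantumFieldTheory Literature.MathematicalPhysics.QuantumLattice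
  Literature.Probability.LatticeModels

section CauchyBinetInjective

variable {k : ℕ} {ι : Type*} [Fintype ι] [DecidableEq ι]

/-- **Cauchy–Binet over injective selections.** For `A : k × ι`, `B : ι × k` over `ℂ`,
`det (A B) = (k!)⁻¹ Σ_{p : Fin k → ι injective} det A[·,p] · det B[p,·]` — the order-free form of the
Cauchy–Binet formula (each `k`-subset of `ι` is counted `k!` times, once per enumeration). -/
theorem det_mul_eq_sum_injective (A : Matrix (Fin k) ι ℂ) (B : Matrix ι (Fin k) ℂ) :
    (A * B).det = ((k.factorial : ℂ))⁻¹ *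
      ∑ p ∈ (univ : Finset (Fin k → ι)).filter (fun p => Function.Injective p),
        (A.submatrix id p).det * (B.submatrix p id).det := by
  classical
  set G : (Fin k → ι) → ℂ := fun p => (∏ i, B (p i) i) * (A.submatrix id p).det with hG
  have hpi : (A * B).det = ∑ p : Fin k → ι, G p :=
    Literature.Analysis.TotalPositivity.det_mul_eq_sum_pi A B
  have hGinj : ∀ p : Fin k → ι, ¬ Function.Injective p → G p = 0 := fun p hp => by
    simp only [hG, Literature.Analysis.TotalPositivity.det_submatrix_eq_zero_of_not_injective A hp,
      mul_zero]
  have hsumG : ∑ p : Fin k → ι, G p =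
      ∑ p ∈ univ.filter (fun p : Fin k → ι => Function.Injective p), G p := by
    rw [Finset.sum_filter]
    refine Finset.sum_congr rfl fun p _ => ?_
    split_ifs with hp
    · rfl
    · exact hGinj p hp
  have hR : ∀ t : Fin k → ι, (A.submatrix id t).det * (B.submatrix t id).det =
      ∑ τ : Equiv.Perm (Fin k), G (t ∘ τ) := by
    intro t
    rw [det_apply' (B.submatrix t id), Finset.mul_sum]
    refine Finset.sum_congr rfl fun τ _ => ?_
    simp only [hG]
    have : A.submatrix id (t ∘ ⇑τ) = (A.submatrix id t).submatrix id τ := rfl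
    rw [this, det_permute']
    simp only [submatrix_apply, id, Function.comp]
    ring
  have hshift : ∀ τ : Equiv.Perm (Fin k),
      ∑ p ∈ univ.filter (fun p : Fin k → ι => Function.Injective p), G (p ∘ τ) =
        ∑ p ∈ univ.filter (fun p : Fin k → ι => Function.Injective p), G p := by
    intro τ
    rw [Finset.sum_filter, Finset.sum_filter]
    refine Fintype.sum_equiv (Equiv.arrowCongr τ.symm (Equiv.refl ι)) _ _ fun p => ?_
    have hcomp : (Equiv.arrowCongr τ.symm (Equiv.refl ι)) p = p ∘ τ := by
      funext i
      simp [Equiv.arrowCongr_apply]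
    have hiff : Function.Injective (p ∘ τ) ↔ Function.Injective p :=
      Function.Injective.of_comp_iff' p τ.bijective
    rw [hcomp]
    by_cases hp : Function.Injective p
    · rw [if_pos hp, if_pos (hiff.2 hp)]
    · rw [if_neg hp, if_neg (fun h => hp (hiff.1 h))]
  have hfac : ((k.factorial : ℂ)) ≠ 0 := by exact_mod_cast (Nat.factorial_pos k).ne'
  symm
  calc ((k.factorial : ℂ))⁻¹ * ∑ p ∈ univ.filter (fun p : Fin k → ι => Function.Injective p),
        (A.submatrix id p).det * (B.submatrix p id).det
      = ((k.factorial : ℂ))⁻¹ * ∑ p ∈ univ.filter (fun p : Fin k → ι => Function.Injective p),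
          ∑ τ : Equiv.Perm (Fin k), G (p ∘ τ) := by simp_rw [hR]
    _ = ((k.factorial : ℂ))⁻¹ * ∑ τ : Equiv.Perm (Fin k),
          ∑ p ∈ univ.filter (fun p : Fin k → ι => Function.Injective p), G (p ∘ τ) := by
        rw [Finset.sum_comm]
    _ = ((k.factorial : ℂ))⁻¹ * ∑ _τ : Equiv.Perm (Fin k),
          ∑ p ∈ univ.filter (fun p : Fin k → ι => Function.Injective p), G p := by
        simp_rw [hshift]
    _ = ∑ p ∈ univ.filter (fun p : Fin k → ι => Function.Injective p), G p := by
        rw [Finset.sum_const, Finset.card_univ, Fintype.card_perm, Fintype.card_fin, nsmul_eq_mul,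
          ← mul_assoc, inv_mul_cancel₀ hfac, one_mul]
    _ = (A * B).det := by rw [hpi, hsumG]

end CauchyBinetInjective

section PrincipalMinors

variable {n : Type*} [Fintype n] [DecidableEq n]

/-- **Principal minors of a conjugated diagonal matrix**: for any square `U`, weights `d` and rows `I`,
`det((U · diag d · Uᴴ)[I,I]) = (r!)⁻¹ Σ_{T injective} det U[I,T] · (∏_b d (T b)) · conj (det U[I,T])`. -/
theorem det_submatrix_mul_diagonal_mul_star {r : ℕ} (U : Matrix n n ℂ) (d : n → ℂ) (I : Fin r → n) :
    ((U * diagonal d * star U).submatrix I I).det = ((r.factorial : ℂ))⁻¹ *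
      ∑ T ∈ (univ : Finset (Fin r → n)).filter (fun T => Function.Injective T),
        (U.submatrix I T).det * (∏ b, d (T b)) * star (U.submatrix I T).det := by
  rw [Matrix.submatrix_mul (U * diagonal d) (star U) I _root_.id I Function.bijective_id,
    det_mul_eq_sum_injective]
  congr 1
  refine Finset.sum_congr rfl fun T _ => ?_
  have h1 : ((U * diagonal d).submatrix I _root_.id).submatrix _root_.id T =
      U.submatrix I T * diagonal (d ∘ T) := by
    ext a b
    simp only [submatrix_apply, mul_diagonal, Function.comp_apply, id]
  have h2 : ((star U).submatrix _root_.id I).submatrix T _root_.id = (U.submatrix I T)ᴴ := by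
    ext a b
    simp only [submatrix_apply, conjTranspose_apply, star_apply, id]
  rw [h1, h2, det_mul, det_diagonal, det_conjTranspose]
  rfl

/-- **`A⁻¹ A⁻ᴴ = Ψ · diag(λ⁻²) · Ψᴴ`** for a Hermitian `A` with `det A ≠ 0` (`Ψ` the eigenvector unitary,
`λ` the real non-zero eigenvalues; `A⁻ᴴ = A⁻¹` and `A⁻¹A⁻¹ = (A A)⁻¹`). -/
theorem inv_mul_inv_conjTranspose_eq_spectral {A : Matrix n n ℂ} (hA : A.IsHermitian) (hdet : A.det ≠ 0) :
    A⁻¹ * (A⁻¹)ᴴ = (hA.eigenvectorUnitary : Matrix n n ℂ) *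
      diagonal (fun t => ((hA.eigenvalues t : ℂ))⁻¹ ^ 2) * star (hA.eigenvectorUnitary : Matrix n n ℂ) := by
  have hinvH : (A⁻¹)ᴴ = A⁻¹ := by rw [conjTranspose_nonsing_inv, hA.eq]
  rw [hinvH, ← Matrix.mul_inv_rev]
  set U : Matrix n n ℂ := (hA.eigenvectorUnitary : Matrix n n ℂ) with hUdef
  have hne : ∀ t, (hA.eigenvalues t : ℂ) ≠ 0 := by
    intro t ht
    apply hdet
    rw [hA.det_eq_prod_eigenvalues]
    exact Finset.prod_eq_zero (Finset.mem_univ t) ht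
  have hUU : star U * U = 1 := Unitary.coe_star_mul_self hA.eigenvectorUnitary
  have hspec : A = U * diagonal (fun t => (hA.eigenvalues t : ℂ)) * star U := by
    conv_lhs => rw [hA.spectral_theorem]
    rw [Unitary.conjStarAlgAut_apply]
    rfl
  set Dg : Matrix n n ℂ := diagonal (fun t => (hA.eigenvalues t : ℂ)) with hDg
  set Di : Matrix n n ℂ := diagonal (fun t => ((hA.eigenvalues t : ℂ))⁻¹ ^ 2) with hDi
  have hAA : A * A = U * (Dg * Dg) * star U := by
    rw [hspec]
    calc U * Dg * star U * (U * Dg * star U) = U * Dg * (star U * U) * Dg * star U := by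
          simp only [Matrix.mul_assoc]
      _ = U * (Dg * Dg) * star U := by rw [hUU, Matrix.mul_one, Matrix.mul_assoc U Dg Dg]
  have hDD : Dg * Dg * Di = 1 := by
    rw [hDg, hDi, diagonal_mul_diagonal, diagonal_mul_diagonal, ← diagonal_one]
    congr 1
    funext t
    field_simp [hne t]
  refine Matrix.inv_eq_right_inv ?_
  calc A * A * (U * Di * star U) = U * (Dg * Dg) * (star U * U) * Di * star U := by
        rw [hAA]; simp only [Matrix.mul_assoc]
    _ = U * (Dg * Dg * Di) * star U := by rw [hUU, Matrix.mul_one]; simp only [Matrix.mul_assoc]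
    _ = 1 := by rw [hDD, Matrix.mul_one]; exact Unitary.coe_mul_star_self hA.eigenvectorUnitary

/-- **Cauchy–Binet spectral expansion of the Gram principal minors** of the inverse of a Hermitian
invertible matrix: `det((A⁻¹A⁻ᴴ)[I,I]) = (r!)⁻¹ Σ_{T injective} ‖det Ψ[I,T]‖² · ∏_b λ_{T b}⁻²` (a real,
non-negative number). -/
theorem det_gram_submatrix_eq_sum {A : Matrix n n ℂ} (hA : A.IsHermitian) (hdet : A.det ≠ 0) {r : ℕ}
    (I : Fin r → n) :
    ((A⁻¹ * (A⁻¹)ᴴ).submatrix I I).det = (((r.factorial : ℝ))⁻¹ *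
      ∑ T ∈ (univ : Finset (Fin r → n)).filter (fun T => Function.Injective T),
        ‖((hA.eigenvectorUnitary : Matrix n n ℂ).submatrix I T).det‖ ^ 2 *
          ∏ b, ((hA.eigenvalues (T b))⁻¹) ^ 2 : ℝ) := by
  rw [inv_mul_inv_conjTranspose_eq_spectral hA hdet, det_submatrix_mul_diagonal_mul_star]
  push_cast
  congr 1
  refine Finset.sum_congr rfl fun T _ => ?_
  rw [mul_right_comm, Complex.star_def, Complex.mul_conj, Complex.normSq_eq_norm_sq]
  push_cast
  rfl

/-- **The weights sum to `r!`**: for a unitary `U` and injective rows `I`,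
`Σ_{T injective} ‖det U[I,T]‖² = r!` (Cauchy–Binet for `(U Uᴴ)[I,I] = 1`).  So `‖det Ψ[I,T]‖²/r!` is a
probability distribution on injective `T` (the projection determinantal point process of the `r`-frame `Ψ[I,·]`,
each `r`-set counted once per enumeration). -/
theorem sum_norm_sq_det_submatrix_eq_factorial {U : Matrix n n ℂ} (hU : U ∈ Matrix.unitaryGroup n ℂ) {r : ℕ}
    {I : Fin r → n} (hI : Function.Injective I) :
    ∑ T ∈ (univ : Finset (Fin r → n)).filter (fun T => Function.Injective T),
      ‖(U.submatrix I T).det‖ ^ 2 = (r.factorial : ℝ) := by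
  have h := det_submatrix_mul_diagonal_mul_star U (fun _ => (1 : ℂ)) I
  rw [diagonal_one, Matrix.mul_one, Matrix.mem_unitaryGroup_iff.1 hU, submatrix_one _ hI, det_one] at h
  have hfac : ((r.factorial : ℂ)) ≠ 0 := by exact_mod_cast (Nat.factorial_pos r).ne'
  have h' : ((r.factorial : ℂ)) = ∑ T ∈ (univ : Finset (Fin r → n)).filter (fun T => Function.Injective T),
      (U.submatrix I T).det * (∏ _b : Fin r, (1 : ℂ)) * star (U.submatrix I T).det := by
    have := congrArg (fun z => ((r.factorial : ℂ)) * z) h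
    simpa [← mul_assoc, mul_inv_cancel₀ hfac] using this
  have h'' : ((r.factorial : ℝ) : ℂ) = ((∑ T ∈ (univ : Finset (Fin r → n)).filter
      (fun T => Function.Injective T), ‖(U.submatrix I T).det‖ ^ 2 : ℝ) : ℂ) := by
    push_cast
    rw [h']
    refine Finset.sum_congr rfl fun T _ => ?_
    rw [Finset.prod_const_one, mul_one, Complex.star_def, Complex.mul_conj, Complex.normSq_eq_norm_sq]
    push_cast
    rfl
  exact_mod_cast h''.symm

end PrincipalMinors

/-! ## Transfer to eigenfunction-weighted inverse spectral moments (Jensen / subadditivity) -/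

section Moments

variable {n : Type*} [Fintype n] [DecidableEq n]

/-- The spectral weight of an `r`-set of modes as a `2q`-th inverse moment:
`(∏_b λ_{T b}⁻²)^q = ∏_b |λ_{T b}|^{-2q}`. -/
theorem prod_inv_sq_rpow_eq {r : ℕ} (lam : Fin r → ℝ) (q : ℝ) :
    (∏ b, (lam b)⁻¹ ^ 2) ^ q = ∏ b, (|lam b|⁻¹) ^ (2 * q) := by
  rw [← Real.finsetProd_rpow _ _ (fun b _ => by positivity)]
  refine Finset.prod_congr rfl fun b _ => ?_
  rw [show ((lam b)⁻¹) ^ 2 = (|lam b|⁻¹) ^ 2 by rw [inv_pow, inv_pow, sq_abs],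
    Real.rpow_mul (by positivity), Real.rpow_two]

/-- **Jensen transfer (`q ≥ 1`)**: for a Hermitian invertible `A` and injective rows `I`,
`det((A⁻¹A⁻ᴴ)[I,I])^q ≤ (r!)⁻¹ Σ_{T injective} ‖det Ψ[I,T]‖² ∏_b |λ_{T b}|^{-2q}` — the `q`-th power of the Gram
minor is dominated by the projection-DPP mean of the `2q`-th inverse moments of `r` distinct eigenvalues. -/
theorem gram_submatrix_rpow_le_sum {A : Matrix n n ℂ} (hA : A.IsHermitian) (hdet : A.det ≠ 0) {r : ℕ}
    {I : Fin r → n} (hI : Function.Injective I) {q : ℝ} (hq : 1 ≤ q) :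
    (((A⁻¹ * (A⁻¹)ᴴ).submatrix I I).det.re) ^ q ≤ ((r.factorial : ℝ))⁻¹ *
      ∑ T ∈ (univ : Finset (Fin r → n)).filter (fun T => Function.Injective T),
        ‖((hA.eigenvectorUnitary : Matrix n n ℂ).submatrix I T).det‖ ^ 2 *
          ∏ b, (|hA.eigenvalues (T b)|⁻¹) ^ (2 * q) := by
  set Ψ : Matrix n n ℂ := (hA.eigenvectorUnitary : Matrix n n ℂ) with hΨ
  set F : Finset (Fin r → n) := (univ : Finset (Fin r → n)).filter (fun T => Function.Injective T) with hF
  set w : (Fin r → n) → ℝ := fun T => ((r.factorial : ℝ))⁻¹ * ‖(Ψ.submatrix I T).det‖ ^ 2 with hw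
  set z : (Fin r → n) → ℝ := fun T => ∏ b, ((hA.eigenvalues (T b))⁻¹) ^ 2 with hz
  have hre : ((A⁻¹ * (A⁻¹)ᴴ).submatrix I I).det.re = ∑ T ∈ F, w T * z T := by
    rw [det_gram_submatrix_eq_sum hA hdet I, Complex.ofReal_re, Finset.mul_sum]
    refine Finset.sum_congr rfl fun T _ => ?_
    simp only [hw, hz]
    ring
  have hw0 : ∀ T ∈ F, 0 ≤ w T := fun T _ => by positivity
  have hw1 : ∑ T ∈ F, w T = 1 := by
    rw [hw, ← Finset.mul_sum, sum_norm_sq_det_submatrix_eq_factorial hA.eigenvectorUnitary.2 hI,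
      inv_mul_cancel₀ (by exact_mod_cast (Nat.factorial_pos r).ne')]
  have hz0 : ∀ T ∈ F, 0 ≤ z T := fun T _ => Finset.prod_nonneg fun b _ => by positivity
  have hJ := Real.rpow_arith_mean_le_arith_mean_rpow F w z hw0 hw1 hz0 hq
  rw [hre]
  refine hJ.trans (le_of_eq ?_)
  rw [Finset.mul_sum]
  refine Finset.sum_congr rfl fun T _ => ?_
  rw [hz, prod_inv_sq_rpow_eq]
  simp only [hw]
  ring

end Moments

/-! ## The Wilson–Dirac instance -/

section Wilson

open Literature.Barriers.QuantumFields

variable {Nf L : ℕ} [NeZero L]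

/-- **`D_W⁻¹ D_W⁻ᴴ = H⁻¹ H⁻ᴴ` with `H = Γ₅ D_W`** (fundamental `SU(3)`, `r = 1`): `D_W = Γ₅ H`, `Γ₅² = 1`,
`Γ₅ᴴ = Γ₅`, so `D_W⁻¹ = H⁻¹ Γ₅` off the singular set, and both sides are Mathlib's junk `0` on it. -/
theorem inv_wilsonDirac_mul_conjTranspose_eq (U : GaugeConfig 4 L SU3) (m : ℝ) :
    (wilsonDirac (fundamentalRep (Fin 3)) U m 1)⁻¹ * ((wilsonDirac (fundamentalRep (Fin 3)) U m 1)⁻¹)ᴴ =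
      (WilsonDeterminant.hermitianWilsonDirac (fundamentalRep (Fin 3)) U m 1)⁻¹ *
        ((WilsonDeterminant.hermitianWilsonDirac (fundamentalRep (Fin 3)) U m 1)⁻¹)ᴴ := by
  set Γ : Matrix (QuarkIdx L) (QuarkIdx L) ℂ := spinorLift gammaFive with hΓdef
  set D : Matrix (QuarkIdx L) (QuarkIdx L) ℂ := wilsonDirac (fundamentalRep (Fin 3)) U m 1 with hDdef
  have hΓΓ : Γ * Γ = 1 := spinorLift_gammaFive_mul_self
  have hΓH : Γᴴ = Γ := WilsonDeterminant.conjTranspose_spinorLift_gammaFive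
  have hH : WilsonDeterminant.hermitianWilsonDirac (fundamentalRep (Fin 3)) U m 1 = Γ * D := rfl
  rw [hH]
  by_cases hdet : D.det = 0
  · have h1 : ¬ IsUnit D.det := by rw [hdet]; exact not_isUnit_zero
    have h2 : ¬ IsUnit (Γ * D).det := by rw [det_mul, hdet, mul_zero]; exact not_isUnit_zero
    rw [nonsing_inv_apply_not_isUnit _ h1, nonsing_inv_apply_not_isUnit _ h2]
  · have hD : D = Γ * (Γ * D) := by rw [← Matrix.mul_assoc, hΓΓ, Matrix.one_mul]
    have hΓinv : Γ⁻¹ = Γ := Matrix.inv_eq_left_inv hΓΓ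
    have hDinv : D⁻¹ = (Γ * D)⁻¹ * Γ := by
      conv_lhs => rw [hD]
      rw [Matrix.mul_inv_rev, hΓinv]
    rw [hDinv, conjTranspose_mul, hΓH, Matrix.mul_assoc, ← Matrix.mul_assoc Γ Γ, hΓΓ, Matrix.one_mul]

/-- **Same-flavour block of the inverse fermion Gram matrix**: with every flavour determinant non-zero,
`((diracMatrix U mq)⁻¹ (diracMatrix U mq)⁻ᴴ)((f,p),(f,r')) = (D_W(m_f)⁻¹ D_W(m_f)⁻ᴴ)(p,r')` (the inverse is
flavour-diagonal, so only same-flavour columns contribute to the Gram sum). -/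
theorem inv_diracMatrix_mul_conjTranspose_apply_same_flavour (U : GaugeConfig 4 L SU3) (mq : Fin Nf → ℝ)
    (h : ∀ g, (wilsonDirac (fundamentalRep (Fin 3)) U (mq g) 1).det ≠ 0) (f : Fin Nf) (p r' : QuarkIdx L) :
    ((diracMatrix U mq)⁻¹ * ((diracMatrix U mq)⁻¹)ᴴ) (quarkEquiv (f, p)) (quarkEquiv (f, r')) =
      ((wilsonDirac (fundamentalRep (Fin 3)) U (mq f) 1)⁻¹ *
        ((wilsonDirac (fundamentalRep (Fin 3)) U (mq f) 1)⁻¹)ᴴ) p r' := by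
  rw [Matrix.mul_apply, Matrix.mul_apply,
    ← Equiv.sum_comp (quarkEquiv (Nf := Nf) (L := L)), Fintype.sum_prod_type, Finset.sum_eq_single f]
  · refine Finset.sum_congr rfl fun s _ => ?_
    rw [conjTranspose_apply, conjTranspose_apply, inv_diracMatrix_apply_same_flavour U mq h f p s,
      inv_diracMatrix_apply_same_flavour U mq h f r' s]
  · intro g _ hgf
    refine Finset.sum_eq_zero fun s _ => ?_
    rw [inv_diracMatrix_apply_of_ne U mq h (Ne.symm hgf) p s, zero_mul]
  · intro hf; exact absurd (Finset.mem_univ f) hf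

/-- **Spectral expansion of the same-flavour Gram minors (equality off the singular set).** With every flavour
determinant non-zero, for rows `I` of flavour `f`:
`det((G Gᴴ)[(f,I),(f,I)]) = (r!)⁻¹ Σ_{T injective} ‖det Ψ_f[I,T]‖² ∏_b λ_{T b}(Γ₅ D_W(m_f))⁻²`. -/
theorem gram_submatrix_diracMatrix_eq_spectral (U : GaugeConfig 4 L SU3) (mq : Fin Nf → ℝ)
    (h : ∀ g, (wilsonDirac (fundamentalRep (Fin 3)) U (mq g) 1).det ≠ 0) (f : Fin Nf) {r : ℕ}
    (I : Fin r → QuarkIdx L) :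
    (Matrix.of fun a b : Fin r =>
        ((diracMatrix U mq)⁻¹ * ((diracMatrix U mq)⁻¹).conjTranspose)
          (quarkEquiv (f, I a)) (quarkEquiv (f, I b))).det =
      ((((r.factorial : ℝ))⁻¹ *
        ∑ T ∈ (univ : Finset (Fin r → QuarkIdx L)).filter (fun T => Function.Injective T),
          ‖(Matrix.of fun a b : Fin r =>
              ((WilsonDeterminant.isHermitian_hermitianWilsonDirac (fundamentalRep (Fin 3))
                  fundamentalRep_mem_unitaryGroup U (mq f) 1).eigenvectorUnitary :
                Matrix (QuarkIdx L) (QuarkIdx L) ℂ) (I a) (T b)).det‖ ^ 2 *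
            ∏ b, ((WilsonDeterminant.isHermitian_hermitianWilsonDirac (fundamentalRep (Fin 3))
              fundamentalRep_mem_unitaryGroup U (mq f) 1).eigenvalues (T b))⁻¹ ^ 2 : ℝ) : ℂ) := by
  set hH := WilsonDeterminant.isHermitian_hermitianWilsonDirac (fundamentalRep (Fin 3))
    fundamentalRep_mem_unitaryGroup U (mq f) 1
  have hmat : (Matrix.of fun a b : Fin r =>
      ((diracMatrix U mq)⁻¹ * ((diracMatrix U mq)⁻¹).conjTranspose) (quarkEquiv (f, I a)) (quarkEquiv (f, I b))) =
      ((WilsonDeterminant.hermitianWilsonDirac (fundamentalRep (Fin 3)) U (mq f) 1)⁻¹ *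
        ((WilsonDeterminant.hermitianWilsonDirac (fundamentalRep (Fin 3)) U (mq f) 1)⁻¹)ᴴ).submatrix I I := by
    ext a b
    rw [Matrix.of_apply, submatrix_apply, inv_diracMatrix_mul_conjTranspose_apply_same_flavour U mq h f,
      inv_wilsonDirac_mul_conjTranspose_eq]
  have hdetH : (WilsonDeterminant.hermitianWilsonDirac (fundamentalRep (Fin 3)) U (mq f) 1).det ≠ 0 := by
    rw [← WilsonDeterminant.fermionDet_wilsonDirac_eq_det_hermitian]
    exact h f
  rw [hmat, det_gram_submatrix_eq_sum hH hdetH I]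
  rfl

/-- **stub `stub_gramSpectralExpansion` (registered additive stub of crux stmt-QuantumFields-9151, line
`crossing-split-integrability`) — spectral domination of the same-flavour Gram minors of the open core.**  For
every `N_f`, torus, coupling data, `SU(3)` field `U`, mass vector, flavour `f`, minor size `r` and rows `I` of
flavour `f`: `Re det((G Gᴴ)[(f,I),(f,I)]) ≤ (r!)⁻¹ Σ_{T injective} ‖det Ψ_f[I,T]‖² ∏_b λ_{T b}(Γ₅ D_W(U,m_f))⁻²`,
`G = (diracMatrix U mq)⁻¹`, `(Ψ_f, λ)` the eigen-decomposition of the Hermitian Wilson–Dirac matrix of flavour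
`f` — with EQUALITY off the null set where some flavour determinant vanishes
(`gram_submatrix_diracMatrix_eq_spectral`), and `Σ_T ‖det Ψ_f[I,T]‖² = r!` for injective `I`
(`sum_norm_sq_det_submatrix_eq_factorial`).  The right-hand side is the exact object an `r`-level phase-quenched
Minami-type estimate has to bound in `stub_gramMomentsCore`. -/
theorem stub_gramSpectralExpansion :
    ∀ (Nf L : ℕ) [NeZero L] (U : GaugeConfig 4 L SU3) (mq : Fin Nf → ℝ) (f : Fin Nf) (r : ℕ)
      (I : Fin r → TorusSite 4 L × Fin 3 × Fin 4),
      (Matrix.of fun a b : Fin r =>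
          ((diracMatrix U mq)⁻¹ * ((diracMatrix U mq)⁻¹).conjTranspose)
            (quarkEquiv (f, I a)) (quarkEquiv (f, I b))).det.re ≤
        ((r.factorial : ℝ))⁻¹ *
          ∑ T ∈ (Finset.univ : Finset (Fin r → TorusSite 4 L × Fin 3 × Fin 4)).filter
              (fun T => Function.Injective T),
            ‖(Matrix.of fun a b : Fin r =>
                ((Literature.Barriers.QuantumFields.WilsonDeterminant.isHermitian_hermitianWilsonDirac
                    (fundamentalRep (Fin 3)) fundamentalRep_mem_unitaryGroup U (mq f) 1).eigenvectorUnitary :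
                  Matrix (TorusSite 4 L × Fin 3 × Fin 4) (TorusSite 4 L × Fin 3 × Fin 4) ℂ) (I a) (T b)).det‖ ^ 2 *
              ∏ b, ((Literature.Barriers.QuantumFields.WilsonDeterminant.isHermitian_hermitianWilsonDirac
                (fundamentalRep (Fin 3)) fundamentalRep_mem_unitaryGroup U (mq f) 1).eigenvalues (T b))⁻¹ ^ 2 := by
  intro Nf L _ U mq f r I
  by_cases h : ∀ g, (wilsonDirac (fundamentalRep (Fin 3)) U (mq g) 1).det ≠ 0
  · rw [gram_submatrix_diracMatrix_eq_spectral U mq h f I, Complex.ofReal_re]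
  · -- singular set: the inverse is Mathlib's junk `0`
    push Not at h
    obtain ⟨g, hg⟩ := h
    have h0 : (diracMatrix U mq).det = 0 := by
      rw [det_diracMatrix]
      exact Finset.prod_eq_zero (Finset.mem_univ g) hg
    have hinv : (diracMatrix U mq)⁻¹ = 0 :=
      nonsing_inv_apply_not_isUnit _ (by rw [h0]; exact not_isUnit_zero)
    rcases Nat.eq_zero_or_pos r with hr | hr
    · subst hr
      have hfilt : (Finset.univ : Finset (Fin 0 → TorusSite 4 L × Fin 3 × Fin 4)).filter
          (fun T => Function.Injective T) = Finset.univ :=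
        Finset.filter_true_of_mem fun T _ => Function.injective_of_subsingleton T
      rw [hfilt]
      simp [Matrix.det_isEmpty]
    · have hzero : (Matrix.of fun a b : Fin r =>
          ((diracMatrix U mq)⁻¹ * ((diracMatrix U mq)⁻¹).conjTranspose)
            (quarkEquiv (f, I a)) (quarkEquiv (f, I b))) = 0 := by
        ext a b
        simp [hinv]
      haveI : Nonempty (Fin r) := ⟨⟨0, hr⟩⟩
      rw [hzero, Matrix.det_zero, Complex.zero_re]
      exact mul_nonneg (by positivity) (Finset.sum_nonneg fun T _ =>
        mul_nonneg (by positivity) (Finset.prod_nonneg fun b _ => by positivity))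

end Wilson

end Summit.QuantumFields.QCD.Cruxes.PhaseQuenchedFlavourDecay.CrossingSplitIntegrability

end
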